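import Literature.Topology.PlaneTopology.CrosscutProofs
import Literature.Probability.RandomPlanarGeometry.LoewnerDescriptionProofs
import Literature.Probability.RandomPlanarGeometry.BoundaryCorrespondence
import Literature.Probability.RandomPlanarGeometry.CaratheodoryHalfPlaneProofs
import HarnessLib

/-!
# Nested Jordan domains: the cyclic order of common free boundary points

Topic `Probability/RandomPlanarGeometry`; theorems only. A planar-topology step of the
transposition of the locality theorem of chordal SLE₆ (G. F. Lawler, O. Schramm, W. Werner,
*Values of Brownian intersection exponents I*, Acta Math. **187** (2001), Thm. 2.2, Cor. 2.4) to
nested Dobrushin domains `D' ⊆ D` whose removed part `F = closure (D ∖ D')` accumulates at the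
target `b` ("buried target"): there the identity of the two stopped SLE₆ laws is obtained along
**free** auxiliary targets (common boundary points off `F`) and boundary arcs of `∂D` and of
`∂D'` between such a target and `b`, and one needs to know that `∂D` and `∂D'` see the common
boundary points `a, b, e, …` in compatible cyclic orders. We PROVE:

* `JordanDomain.not_separated_of_nested` — if `L` is a cross-cut of `D'` (hence of `D ⊇ D'`)
  between two common boundary points `p, q` with `p ∉ closure (D ∖ D')`, then two common
  boundary points separated by `{p, q}` on `∂D'` are separated by `{p, q}` on `∂D`. Proof from
  Newman's cross-cut theorem (Newman (1939), Ch. V §11, Thms. 11·7–11·8, proved in the tree,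
  `Newman1939_crosscut_holds`) applied in `D'` and in `D`: otherwise both components of
  `D' ∖ L` lie in one component of `D ∖ L`, the other component of `D ∖ L` misses `D'`, and
  its boundary point `p` lies in `closure (D ∖ D')`;
* `JordanDomain.isSimpleArc_image_semicircle`, `MarkedDomain.exists_isCrosscut_pt_zero` —
  cross-cuts of a Dobrushin domain from `a = pt 0` to any other boundary point `q ≠ b`: the
  image of a half-plane semicircle under the boundary extension of a chordal uniformizing map
  (continuous and injective on the closed half-plane by Carathéodory's theorem, Pommerenke
  (1992), Thm. 2.6, `JordanDomain.injOn_boundaryExtension`);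
* `MarkedDomain.boundary_mem_closure_diff_of_mem_uIcc` — the consequence consumed by the
  locality proof: if the arc of `∂D` from `e` to `b` not containing `a` lies in `F`, so does the
  arc of `∂D'` from `e` to `b` not containing `a`.

## References

* M. H. A. Newman, *Elements of the topology of plane sets of points* (1939), Ch. V §11.
  [Newman1939]
* Ch. Pommerenke, *Boundary Behaviour of Conformal Maps* (1992), Thm. 2.6. [PommerenkeBBCM1992]
* G. F. Lawler, O. Schramm, W. Werner, Acta Math. 187 (2001), §2. [LawlerSchrammWerner2001]
-/

noncomputable section

open Set Filter Topology Complex Metric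
open UpperHalfPlane (upperHalfPlaneSet)
open Literature.Topology.PlaneTopology

namespace Literature.Probability.RandomPlanarGeometry

/-! ### Separation of common boundary points of nested Jordan domains -/

namespace JordanDomain

/-- A point of the boundary loop is not in the (open) domain. [folklore] -/
theorem boundary_notMem_carrier (D : JordanDomain) (t : ℝ) : D.boundary t ∉ D.carrier := by
  have h := (D.boundary_mem_frontier t).2
  rwa [D.isOpen.interior_eq] at h

/-- **Common free boundary points of nested Jordan domains are met in compatible cyclic
orders.** Let `D' ⊆ D` be Jordan domains with `D'.boundary 0 = D.boundary 0 =: p` off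
`closure (D ∖ D')`, let `q = D'.boundary s' = D.boundary s` (`s, s' ∈ (0, 1)`) and let `L` be a
cross-cut of `D'` from `p` to `q`. If two points `w₁ = D'.boundary u₁ = D.boundary v₁`,
`w₂ = D'.boundary u₂ = D.boundary v₂` are separated by `{p, q}` on `∂D'` (`u₁ < s' < u₂`), they
cannot lie on a common arc of `∂D ∖ {p, q}` (`v₁, v₂` both in `(s, 1)` or both in `(0, s)`).
Newman (1939), Ch. V §11, Thms. 11·7–11·8, applied in `D'` and in `D`.
[cite: Newman1939, Ch. V §11, Thms. 11·7 and 11·8] -/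
theorem not_separated_of_nested {D D' : JordanDomain} (hsub : D'.carrier ⊆ D.carrier)
    {L : Set ℂ} {s s' : ℝ} (hs : s ∈ Ioo (0 : ℝ) 1) (hs' : s' ∈ Ioo (0 : ℝ) 1)
    (h0 : D'.boundary 0 = D.boundary 0) (hq : D'.boundary s' = D.boundary s)
    (hL : D'.IsCrosscut L (D'.boundary 0) (D'.boundary s'))
    (hfree : D.boundary 0 ∉ closure (D.carrier \ D'.carrier))
    {u₁ u₂ v₁ v₂ : ℝ} (hu₁ : u₁ ∈ Ioo 0 s') (hu₂ : u₂ ∈ Ioo s' 1)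
    (hw₁ : D'.boundary u₁ = D.boundary v₁) (hw₂ : D'.boundary u₂ = D.boundary v₂)
    (hv : (v₁ ∈ Ioo s 1 ∧ v₂ ∈ Ioo s 1) ∨ (v₁ ∈ Ioo 0 s ∧ v₂ ∈ Ioo 0 s)) : False := by
  have hN := Newman1939_crosscut_holds
  obtain ⟨hLarc, -, -, -, hLD'⟩ := hL
  have hpL : D'.boundary 0 ∈ L := hLarc.left_mem
  -- `L` is also a cross-cut of `D`
  have hL_D : D.IsCrosscut L (D.boundary 0) (D.boundary s) := by
    refine ⟨by rw [← h0, ← hq]; exact hLarc, D.boundary_mem_frontier 0, D.boundary_mem_frontier s,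
      fun h ↦ ?_, fun z hz ↦ hsub (hLD' (by rwa [h0, hq]))⟩
    have := D.injOn_boundary ⟨le_rfl, one_pos⟩ ⟨hs.1.le, hs.2⟩ h
    exact hs.1.ne this
  -- Newman in `D'` and in `D`
  obtain ⟨U₁, U₂, -, -, hU₁c, hU₂c, -, hUunion, hfU₁, hfU₂⟩ :=
    hN D' L 0 s' hs'.1 (by linarith [hs'.2]) ⟨hLarc, D'.boundary_mem_frontier 0,
      D'.boundary_mem_frontier s', fun h ↦ hs'.1.ne
        (D'.injOn_boundary ⟨le_rfl, one_pos⟩ ⟨hs'.1.le, hs'.2⟩ h), hLD'⟩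
  obtain ⟨V₁, V₂, hV₁o, hV₂o, -, -, hVdisj, hVunion, hfV₁, hfV₂⟩ :=
    hN D L 0 s hs.1 (by linarith [hs.2]) hL_D
  rw [zero_add] at hfU₂ hfV₂
  -- the two points are on the frontiers of the two components of `D' ∖ L`
  have hw₁U : D'.boundary u₁ ∈ frontier U₁ := by
    rw [hfU₁]; exact Or.inr ⟨u₁, ⟨hu₁.1.le, hu₁.2.le⟩, rfl⟩
  have hw₂U : D'.boundary u₂ ∈ frontier U₂ := by
    rw [hfU₂]; exact Or.inr ⟨u₂, ⟨hu₂.1.le, hu₂.2.le⟩, rfl⟩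
  -- they are off `L`
  have hoffL : ∀ {u : ℝ}, u ∈ Ioo (0 : ℝ) 1 → u ≠ s' → D'.boundary u ∉ L := by
    intro u hu hus huL
    have hD' : D'.boundary u ∉ D'.carrier := D'.boundary_notMem_carrier u
    have hmem : D'.boundary u ∈ ({D'.boundary 0, D'.boundary s'} : Set ℂ) := by
      by_contra h
      exact hD' (hLD' ⟨huL, h⟩)
    rcases hmem with h | h
    · exact hu.1.ne' (D'.injOn_boundary ⟨hu.1.le, hu.2⟩ ⟨le_rfl, one_pos⟩ h)
    · exact hus (D'.injOn_boundary ⟨hu.1.le, hu.2⟩ ⟨hs'.1.le, hs'.2⟩ h)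
  have hw₁L : D'.boundary u₁ ∉ L := hoffL ⟨hu₁.1, hu₁.2.trans hs'.2⟩ hu₁.2.ne
  have hw₂L : D'.boundary u₂ ∉ L := hoffL ⟨hs'.1.trans hu₂.1, hu₂.2⟩ hu₂.1.ne'
  -- the components of `D' ∖ L` inside `D ∖ L = V₁ ∪ V₂`
  have hUsub : ∀ {U : Set ℂ}, U ⊆ U₁ ∪ U₂ → U ⊆ V₁ ∪ V₂ := fun {U} h z hz ↦ by
    rw [hVunion]
    have := h hz
    rw [hUunion] at this
    exact ⟨hsub this.1, this.2⟩
  -- common tail: both points off the closure of one `D`-component `V` whose frontier contains `p`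
  have tail : ∀ V W : Set ℂ, IsOpen V → IsOpen W → Disjoint V W → V ∪ W = V₁ ∪ V₂ →
      D.boundary 0 ∈ frontier V → D'.boundary u₁ ∉ closure V → D'.boundary u₂ ∉ closure V →
      False := by
    intro V W hVo hWo hVW hunion hpV h₁ h₂
    have hU₁W : U₁ ⊆ W := by
      rcases hU₁c.isPreconnected.subset_or_subset hVo hWo hVW
        (hunion ▸ hUsub subset_union_left) with h | h
      · exact absurd (closure_mono h (frontier_subset_closure hw₁U)) h₁
      · exact h
    have hU₂W : U₂ ⊆ W := by
      rcases hU₂c.isPreconnected.subset_or_subset hVo hWo hVW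
        (hunion ▸ hUsub subset_union_right) with h | h
      · exact absurd (closure_mono h (frontier_subset_closure hw₂U)) h₂
      · exact h
    -- so `V` misses `D'`
    have hVsub : V ⊆ D.carrier \ D'.carrier := by
      intro z hz
      have hzVV : z ∈ V₁ ∪ V₂ := hunion ▸ Or.inl hz
      rw [hVunion] at hzVV
      refine ⟨hzVV.1, fun hzD' ↦ ?_⟩
      have hzU : z ∈ U₁ ∪ U₂ := by rw [hUunion]; exact ⟨hzD', hzVV.2⟩
      have hzW : z ∈ W := hzU.elim (fun h ↦ hU₁W h) (fun h ↦ hU₂W h)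
      exact Set.disjoint_left.1 hVW hz hzW
    exact hfree (closure_mono hVsub (frontier_subset_closure hpV))
  have hpL' : D.boundary 0 ∈ L := h0 ▸ hpL
  rcases hv with ⟨hv₁, hv₂⟩ | ⟨hv₁, hv₂⟩
  · -- both on the arc `(s, 1)`: off `closure V₁ = V₁ ∪ L ∪ ∂D[0, s]`
    have hoff : ∀ {u v : ℝ}, v ∈ Ioo s 1 → D'.boundary u = D.boundary v → D'.boundary u ∉ L →
        D'.boundary u ∉ closure V₁ := by
      intro u v hv' huv huL hcl
      rw [closure_eq_self_union_frontier, hfV₁] at hcl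
      rcases hcl with h | h | ⟨r, hr, hrv⟩
      · have hV₁D : V₁ ⊆ D.carrier := fun z hz ↦ ((hVunion ▸ Or.inl hz : z ∈ D.carrier \ L)).1
        rw [huv] at h
        exact D.boundary_notMem_carrier v (hV₁D h)
      · exact huL h
      · rw [huv] at hrv
        have := D.injOn_boundary ⟨hr.1, hr.2.trans_lt hs.2⟩ ⟨hs.1.le.trans hv'.1.le, hv'.2⟩ hrv
        exact absurd (hr.2.trans_lt hv'.1) (not_lt.2 this.ge)
    refine tail V₁ V₂ hV₁o hV₂o hVdisj rfl (by rw [hfV₁]; exact Or.inl hpL') (hoff hv₁ hw₁ hw₁L)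
      (hoff hv₂ hw₂ hw₂L)
  · -- both on the arc `(0, s)`: off `closure V₂ = V₂ ∪ L ∪ ∂D[s, 1]`
    have hoff : ∀ {u v : ℝ}, v ∈ Ioo 0 s → D'.boundary u = D.boundary v → D'.boundary u ∉ L →
        D'.boundary u ∉ closure V₂ := by
      intro u v hv' huv huL hcl
      rw [closure_eq_self_union_frontier, hfV₂] at hcl
      rcases hcl with h | h | ⟨r, hr, hrv⟩
      · have hV₂D : V₂ ⊆ D.carrier := fun z hz ↦ ((hVunion ▸ Or.inr hz : z ∈ D.carrier \ L)).1
        rw [huv] at h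
        exact D.boundary_notMem_carrier v (hV₂D h)
      · exact huL h
      · rw [huv] at hrv
        rcases hr.2.lt_or_eq with hr1 | hr1
        · have := D.injOn_boundary ⟨hs.1.le.trans hr.1, hr1⟩ ⟨hv'.1.le, hv'.2.trans hs.2⟩ hrv
          exact absurd (hv'.2.trans_le hr.1) (not_lt.2 this.le)
        · -- `r = 1`: the point would be `p = D.boundary 0`, i.e. `v = 0`
          rw [hr1, D.periodic_boundary.eq] at hrv
          have := D.injOn_boundary ⟨le_rfl, one_pos⟩ ⟨hv'.1.le, hv'.2.trans hs.2⟩ hrv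
          exact hv'.1.ne this
    refine tail V₂ V₁ hV₂o hV₁o hVdisj.symm (union_comm _ _)
      (by rw [hfV₂]; exact Or.inl hpL') (hoff hv₁ hw₁ hw₁L) (hoff hv₂ hw₂ hw₂L)

/-! ### Cross-cuts from a chordal uniformizing map -/

/-- **Images of half-plane semicircles are simple arcs.** For a conformal map `φ : ℍₒ → D`
onto a Jordan domain and reals `x₁ < x₂`, the image under the boundary extension of `φ` of
the closed upper semicircle on `[x₁, x₂]` is a simple arc from `Φ x₂` to `Φ x₁` whose interior
points lie in `D` (Carathéodory: the extension is continuous and injective on the closed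
half-plane). [cite: PommerenkeBBCM1992, Thm. 2.6] -/
theorem isSimpleArc_image_semicircle {D : JordanDomain}
    (φ : ConformalEquiv upperHalfPlaneSet D.carrier) {x₁ x₂ : ℝ} (hx : x₁ < x₂) :
    IsSimpleArc ((fun θ : ℝ ↦ φ.boundaryExtension
        ((((x₁ + x₂) / 2 : ℝ) : ℂ) + circleMap 0 ((x₂ - x₁) / 2) (Real.pi * θ))) '' Icc 0 1)
      (φ.boundaryExtension x₂) (φ.boundaryExtension x₁) ∧
    (∀ θ ∈ Ioo (0 : ℝ) 1, φ.boundaryExtension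
        ((((x₁ + x₂) / 2 : ℝ) : ℂ) + circleMap 0 ((x₂ - x₁) / 2) (Real.pi * θ)) ∈ D.carrier) ∧
    φ.boundaryExtension ((((x₁ + x₂) / 2 : ℝ) : ℂ) + circleMap 0 ((x₂ - x₁) / 2) (Real.pi * 0)) =
      φ.boundaryExtension x₂ ∧
    φ.boundaryExtension ((((x₁ + x₂) / 2 : ℝ) : ℂ) + circleMap 0 ((x₂ - x₁) / 2) (Real.pi * 1)) =
      φ.boundaryExtension x₁ := by
  set c : ℝ := (x₁ + x₂) / 2 with hc
  set ρ : ℝ := (x₂ - x₁) / 2 with hρ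
  have hρ0 : 0 < ρ := by rw [hρ]; linarith
  set sc : ℝ → ℂ := fun θ ↦ (c : ℂ) + circleMap 0 ρ (Real.pi * θ) with hsc
  have hsc_cont : Continuous sc :=
    continuous_const.add ((continuous_circleMap 0 ρ).comp (continuous_const.mul continuous_id))
  have hsc_im : ∀ θ, (sc θ).im = ρ * Real.sin (Real.pi * θ) := fun θ ↦ by
    simp [hsc, circleMap_zero_im]
  have him : ∀ θ ∈ Icc (0 : ℝ) 1, 0 ≤ (sc θ).im := fun θ hθ ↦ by
    rw [hsc_im]
    exact mul_nonneg hρ0.le (Real.sin_nonneg_of_nonneg_of_le_pi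
      (mul_nonneg Real.pi_pos.le hθ.1) (by nlinarith [Real.pi_pos, hθ.2]))
  have hpos : ∀ θ ∈ Ioo (0 : ℝ) 1, 0 < (sc θ).im := fun θ hθ ↦ by
    rw [hsc_im]
    exact mul_pos hρ0 (Real.sin_pos_of_pos_of_lt_pi (mul_pos Real.pi_pos hθ.1)
      (by nlinarith [Real.pi_pos, hθ.2]))
  have hcl : closure upperHalfPlaneSet = {w : ℂ | 0 ≤ w.im} := Complex.closure_setOf_lt_im 0
  have hΦc : ContinuousOn φ.boundaryExtension {w : ℂ | 0 ≤ w.im} :=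
    hcl ▸ JordanDomain.continuousOn_boundaryExtension_holds D φ
  have hΦi : InjOn φ.boundaryExtension {w : ℂ | 0 ≤ w.im} := JordanDomain.injOn_boundaryExtension φ
  have hsc0 : sc 0 = x₂ := by
    simp only [hsc, mul_zero, circleMap, Complex.ofReal_zero, zero_mul, Complex.exp_zero, mul_one,
      zero_add, hc, hρ]
    push_cast; ring
  have hsc1 : sc 1 = x₁ := by
    simp only [hsc, mul_one, circleMap, zero_add, hc, hρ]
    rw [Complex.exp_pi_mul_I]
    push_cast; ring
  refine ⟨⟨fun θ ↦ φ.boundaryExtension (sc θ), ?_, ?_, rfl, by simp [hsc0], by simp [hsc1]⟩,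
    fun θ hθ ↦ ?_, ?_, ?_⟩
  rotate_left 3
  · show φ.boundaryExtension (sc 0) = _
    rw [hsc0]
  · show φ.boundaryExtension (sc 1) = _
    rw [hsc1]
  · exact hΦc.comp hsc_cont.continuousOn fun θ hθ ↦ him θ hθ
  · intro θ₁ hθ₁ θ₂ hθ₂ heq
    have h1 : sc θ₁ = sc θ₂ := hΦi (him θ₁ hθ₁) (him θ₂ hθ₂) heq
    have h2 : circleMap 0 ρ (Real.pi * θ₁) = circleMap 0 ρ (Real.pi * θ₂) := add_left_cancel h1
    have h3 : Real.pi * θ₁ = Real.pi * θ₂ := by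
      refine eq_of_circleMap_eq hρ0.ne' ?_ h2
      rw [abs_lt]
      constructor <;> nlinarith [Real.pi_pos, hθ₁.1, hθ₁.2, hθ₂.1, hθ₂.2]
    exact mul_left_cancel₀ Real.pi_pos.ne' h3
  · have hH : sc θ ∈ upperHalfPlaneSet := hpos θ hθ
    rw [show ((((x₁ + x₂) / 2 : ℝ) : ℂ) + circleMap 0 ((x₂ - x₁) / 2) (Real.pi * θ)) = sc θ from rfl,
      φ.boundaryExtension_eq hH]
    exact φ.mapsTo hH

end JordanDomain

namespace MarkedDomain

/-- **A Dobrushin domain has a cross-cut from `a = pt 0` to any other boundary point `q ≠ b`**: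
the image of the half-plane semicircle on `[0, x]` (resp. `[x, 0]`), `x` the real point sent to
`q` by the boundary extension of a chordal uniformizing map (boundary correspondence,
Pommerenke (1992), Thm. 2.6). [cite: PommerenkeBBCM1992, Thm. 2.6] -/
theorem exists_isCrosscut_pt_zero (D : DobrushinDomain) {q : ℂ} (hq : q ∈ frontier D.carrier)
    (hq0 : q ≠ D.pt 0) (hq1 : q ≠ D.pt 1) : ∃ L : Set ℂ, D.IsCrosscut L (D.pt 0) q := by
  obtain ⟨ψ, hψ⟩ := MarkedDomain.exists_isChordalUniformizing_holds D
  have hC := JordanDomain.exists_continuousOn_extension_holds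
  -- the real preimage `x ≠ 0` of `q`
  have hx : ∃ x : ℝ, ψ.boundaryExtension x = q := by
    rcases JordanDomain.existsUnique_real_or_infty_of_disc hC D.toJordanDomain ψ hq with
      ⟨x, hxq, -⟩ | hinf
    · exact ⟨x, ψ.boundaryExtension_eq_of_hasBoundaryValue
        (mem_closure_upperHalfPlaneSet_iff.2 (by simp)) hxq⟩
    · haveI := neBot_cocompact_inf_principal_upperHalfPlaneSet
      exact absurd (tendsto_nhds_unique hinf hψ.2) hq1
  obtain ⟨x, hxq⟩ := hx
  have h0 : ψ.boundaryExtension ((0 : ℝ) : ℂ) = D.pt 0 :=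
    ψ.boundaryExtension_eq_of_hasBoundaryValue (mem_closure_upperHalfPlaneSet_iff.2 (by simp))
      (by simpa using hψ.1)
  have hx0 : x ≠ 0 := by
    rintro rfl
    exact hq0 (hxq.symm.trans h0)
  -- the semicircle arc, oriented from `pt 0` to `q`
  have key : ∀ {x₁ x₂ : ℝ}, x₁ < x₂ →
      ∃ L : Set ℂ, IsSimpleArc L (ψ.boundaryExtension x₂) (ψ.boundaryExtension x₁) ∧
        L \ {ψ.boundaryExtension x₂, ψ.boundaryExtension x₁} ⊆ D.carrier := by
    intro x₁ x₂ hlt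
    obtain ⟨harc, hint, hend0, hend1⟩ := JordanDomain.isSimpleArc_image_semicircle ψ hlt
    refine ⟨_, harc, ?_⟩
    rintro z ⟨⟨θ, hθ, rfl⟩, hz⟩
    rcases hθ.1.lt_or_eq with hθ0 | hθ0
    · rcases hθ.2.lt_or_eq with hθ1 | hθ1
      · exact hint θ ⟨hθ0, hθ1⟩
      · refine absurd (Or.inr ?_) hz
        rw [hθ1]
        exact hend1
    · refine absurd (Or.inl ?_) hz
      rw [← hθ0]
      exact hend0
  have hcross : ∀ {L : Set ℂ}, IsSimpleArc L (D.pt 0) q → L \ {D.pt 0, q} ⊆ D.carrier →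
      D.IsCrosscut L (D.pt 0) q := fun {L} h1 h2 ↦
    ⟨h1, D.pt_mem_frontier 0, hq, fun h ↦ hq0 h.symm, h2⟩
  rcases lt_or_gt_of_ne hx0 with hneg | hpos
  · obtain ⟨L, harc, hsub⟩ := key hneg
    rw [h0, hxq] at harc hsub
    exact ⟨L, hcross harc hsub⟩
  · obtain ⟨L, harc, hsub⟩ := key hpos
    rw [h0, hxq] at harc hsub
    rw [Set.pair_comm] at hsub
    exact ⟨L, hcross harc.symm hsub⟩

/-! ### The consequence for the buried-target locality proof -/

/-- For a Dobrushin domain based at parameter `0`, `pt 0 = boundary 0`. [folklore] -/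
theorem pt_zero_eq_boundary_zero {D : DobrushinDomain} (h : D.mark 0 = 0) : D.pt 0 = D.boundary 0 := by
  rw [MarkedDomain.pt, h]

/-- **The `∂D'`-arc from `e` to `b` avoiding `a` is buried when the `∂D`-arc is.** Let `D' ⊆ D`
be Dobrushin domains with the same marked points `a = pt 0`, `b = pt 1`, both loops based at
`a` (`mark 0 = 0`), `a ∉ F := closure (D ∖ D')`. If the arc `D.boundary '' [σ, D.mark 1]` of `∂D`
(from `e = D.boundary σ` to `b`, `0 < σ`) lies in `F`, and `e = D'.boundary uₑ` with
`uₑ ∈ (0, 1)`, then the arc of `∂D'` between `e` and `b` not containing `a`,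
`D'.boundary '' uIcc uₑ (D'.mark 1)`, lies in `F`: a free point `q` strictly inside it would give,
with a cross-cut of `D'` from `a` to `q`, a pair `{e, b}` separated by `{a, q}` on `∂D'` but not
on `∂D`, contradicting `JordanDomain.not_separated_of_nested`.
[cite: Newman1939, Ch. V §11, Thms. 11·7 and 11·8] -/
theorem boundary_mem_closure_diff_of_mem_uIcc {D D' : DobrushinDomain} (hD : D.mark 0 = 0)
    (hD' : D'.mark 0 = 0) (hsub : D'.carrier ⊆ D.carrier) (h0 : D'.pt 0 = D.pt 0)
    (h1 : D'.pt 1 = D.pt 1) (ha : D.pt 0 ∉ closure (D.carrier \ D'.carrier))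
    {σ : ℝ} (hσ0 : 0 < σ) (hσ1 : σ ≤ D.mark 1)
    (hF : ∀ s ∈ Icc σ (D.mark 1), D.boundary s ∈ closure (D.carrier \ D'.carrier))
    {ue : ℝ} (hue : ue ∈ Ioo (0 : ℝ) 1) (he : D'.boundary ue = D.boundary σ)
    {r : ℝ} (hr : r ∈ uIcc ue (D'.mark 1)) :
    D'.boundary r ∈ closure (D.carrier \ D'.carrier) := by
  set F : Set ℂ := closure (D.carrier \ D'.carrier) with hFdef
  have hm1 : D.mark 1 ∈ Ico (0 : ℝ) 1 := D.mark_mem 1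
  have hm1' : D'.mark 1 ∈ Ico (0 : ℝ) 1 := D'.mark_mem 1
  have hm01' : 0 < D'.mark 1 := by
    have := D'.strictMono_mark (show (0 : Fin 2) < 1 by decide)
    rwa [hD'] at this
  have hb : D'.boundary (D'.mark 1) = D.boundary (D.mark 1) := h1
  have ha0 : D.boundary 0 ∉ F := pt_zero_eq_boundary_zero hD ▸ ha
  have ha0' : D'.boundary 0 = D.boundary 0 := by
    rw [← pt_zero_eq_boundary_zero hD, ← pt_zero_eq_boundary_zero hD']; exact h0
  -- endpoints
  by_cases hre : r = ue
  · rw [hre, he]; exact hF σ ⟨le_rfl, hσ1⟩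
  by_cases hrb : r = D'.mark 1
  · rw [hrb, hb]; exact hF _ ⟨hσ1, le_rfl⟩
  -- an interior point: suppose it is free
  by_contra hq
  have hrlo : min ue (D'.mark 1) < r := lt_of_le_of_ne hr.1 (by
    rcases min_choice ue (D'.mark 1) with h | h <;> rw [h]
    · exact Ne.symm hre
    · exact Ne.symm hrb)
  have hrhi : r < max ue (D'.mark 1) := lt_of_le_of_ne hr.2 (by
    rcases max_choice ue (D'.mark 1) with h | h <;> rw [h]
    · exact hre
    · exact hrb)
  have hr01 : r ∈ Ioo (0 : ℝ) 1 :=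
    ⟨(lt_min hue.1 hm01').trans hrlo, hrhi.trans (max_lt hue.2 hm1'.2)⟩
  set q : ℂ := D'.boundary r with hqdef
  -- `q` is a boundary point of `D` as well
  have hqD' : q ∈ frontier D'.carrier := D'.boundary_mem_frontier r
  have hqD : q ∈ frontier D.carrier := by
    refine ⟨closure_mono hsub (frontier_subset_closure hqD'), ?_⟩
    rw [D.isOpen.interior_eq]
    intro hqDc
    exact hq (subset_closure ⟨hqDc, D'.boundary_notMem_carrier r⟩)
  rw [D.frontier_eq_image_Ico] at hqD
  obtain ⟨s, hs, hsq⟩ := hqD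
  have hs0 : s ≠ 0 := by
    rintro rfl
    have : D'.boundary r = D'.boundary 0 := by rw [ha0']; exact hsq.symm
    exact hr01.1.ne' (D'.injOn_boundary ⟨hr01.1.le, hr01.2⟩ ⟨le_rfl, one_pos⟩ this)
  have hsI : s ∈ Ioo (0 : ℝ) 1 := ⟨lt_of_le_of_ne hs.1 (Ne.symm hs0), hs.2⟩
  have hsF : s ∉ Icc σ (D.mark 1) := fun h ↦ hq (hsq ▸ hF s h)
  -- a cross-cut of `D'` from `a` to `q`
  have hq0 : q ≠ D'.pt 0 := by
    rw [pt_zero_eq_boundary_zero hD']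
    intro h
    exact hr01.1.ne' (D'.injOn_boundary ⟨hr01.1.le, hr01.2⟩ ⟨le_rfl, one_pos⟩ h)
  have hq1 : q ≠ D'.pt 1 := fun h ↦
    hrb (D'.injOn_boundary ⟨hr01.1.le, hr01.2⟩ hm1' h)
  obtain ⟨L, hL⟩ := exists_isCrosscut_pt_zero D' hqD' hq0 hq1
  rw [pt_zero_eq_boundary_zero hD'] at hL
  -- the separation data: on `∂D`, `σ` and `D.mark 1` are on the same side of `s`
  have hv : (σ ∈ Ioo s 1 ∧ D.mark 1 ∈ Ioo s 1) ∨ (σ ∈ Ioo 0 s ∧ D.mark 1 ∈ Ioo 0 s) := by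
    rcases lt_or_ge s σ with h | h
    · exact Or.inl ⟨⟨h, hσ1.trans_lt hm1.2⟩, ⟨h.trans_le hσ1, hm1.2⟩⟩
    · have h' : D.mark 1 < s := lt_of_not_ge fun h'' ↦ hsF ⟨h, h''⟩
      exact Or.inr ⟨⟨hσ0, hσ1.trans_lt h'⟩, ⟨hσ0.trans_le hσ1, h'⟩⟩
  -- on `∂D'`, `ue` and `D'.mark 1` are separated by `r`
  rcases le_total ue (D'.mark 1) with hle | hle
  · rw [min_eq_left hle] at hrlo
    rw [max_eq_right hle] at hrhi
    exact JordanDomain.not_separated_of_nested hsub hsI hr01 ha0' hsq.symm hL ha0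
      ⟨hue.1, hrlo⟩ ⟨hrhi, hm1'.2⟩ he hb hv
  · rw [min_eq_right hle] at hrlo
    rw [max_eq_left hle] at hrhi
    exact JordanDomain.not_separated_of_nested hsub hsI hr01 ha0' hsq.symm hL ha0
      ⟨hm01', hrlo⟩ ⟨hrhi, hue.2⟩ hb he (hv.imp And.symm And.symm)

end MarkedDomain

end Literature.Probability.RandomPlanarGeometry

end
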